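import Summits.HodgeConjecture.CorCM.GaloisOddMetacyclicCertificates
import HarnessLib

/-!
# `Gal(K/ℚ) ≅ C₇ ⋊ C₁₆` is BAD: a simple DEGENERATE CM abelian `56`-fold (kernel certificate)

COR-CM (cell `pub-hodgecm2`), binder seat b04 (gen 26), count-neutral claim CYCLIC-SEMIDIRECT-RESIDUE, part VII♯d — `C₇ ⋊ C₁₆`
(order `112`, inversion action, `a = 2`, `p = 7`: `2^{a+1} = 8 ∣ p + 1`, so a primitive eighth root of unity is a norm from
`ℚ(ζ₅₆)` to the fixed field of `ζ ↦ ζ^{e}` and the GOOD mechanism of `CorCM/GaloisCyclicSemidirectTwoPowerResidue` fails — whereas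
`C₇ ⋊ C₃₂` (`a = 3`) is GOOD there, and `C₇ ⋊ C₈` (`a = 1`) is BAD, `CorCM/GaloisFiftySixC7SemidirectC8Degenerate`).  The seat census
(two-sheet over the `8⁷ × 8⁷` interval types; gen 25 compute j192121: `4.5·10⁹` degenerate incidences, all sampled ones primitive;
gen 26 j199909: the kernel lattice of a primitive degenerate type, dimension `24 = 4(p−1)`, has an LLL basis with entries in `{0, ±1}`)
gives the balanced set of size `12` recorded here, checked by `decide` through `GaloisOddMetacyclic.exists_simple_degenerate_of_
inversion_balanced` (`a := 2`), under the SAME hypothesis `e : Gal(K/ℚ) ≃* Multiplicative (ZMod 7) ⋊[φ] Multiplicative (ZMod 16)`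
(`φ(1)` = inversion) as the GOOD theorems.  KERNEL ONLY: theorems; no definition, no named fact, no `sorry`.  `HC_CM` is neither
used nor claimed.

THE CERTIFICATE (coordinates `(v, s) ↔ u^v y^s ∈ ℤ/7 × ℤ/16`, law `(v₁,s₁)(v₂,s₂) = (v₁ + 6^{s₁} v₂, s₁+s₂)`, `c₀ = (0,8)`): the CM
set `T₀` is the two-sheet type with interval fibres (`{t, …, t+3} ⊂ ℤ/8`) `t = (4,4,6,5,6,7,1)`, `t' = (0,2,5,0,1,3,7)` (B-rank
`57 − 24`); `D = {(0,1), (0,5), (1,0), (1,6), (1,13), (1,15), (2,11), (2,14), (3,7), (3,9), (4,3), (4,8)}`.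

* **`exists_simple_degenerate_cyclic7_semidirect_16`** — a simple degenerate abelian variety of dimension `56` with CM by `K`
  and a rational `(q,q)` class outside the divisor ring on some power: `C₇ ⋊ C₁₆` is BAD.

## References

* [Shimura1998] G. Shimura, *Abelian Varieties with Complex Multiplication and Modular Functions*, §6.2 Thm. 3, §8.2 Prop. 26.
* [Gordon1999HodgeAVSurvey] B. B. Gordon, *A survey of the Hodge conjecture for abelian varieties*, Thm. 6.4, §9.3.
-/

noncomputable section

open CategoryTheory CategoryTheory.Limits NumberField
open scoped BigOperators

namespace Summit.HodgeConjecture.CorCM.GaloisOddMetacyclic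

open Literature.NumberTheory.ComplexMultiplication
open Literature.AlgebraicGeometry.Motives (AbelianVariety CMType)
open Literature.AlgebraicGeometry.HodgeTheory
open Literature.AlgebraicGeometry.ComplexMultiplication (IsCMTypeRealisation)
open Literature.AlgebraicGeometry.Pohlmann1968
open Literature.Barriers.HodgeConjecture (divisorClassesSpan)

variable {K : Type} [Field K] [NumberField K] [IsCMField K] [IsGalois ℚ K]

set_option maxHeartbeats 400000 in
set_option maxRecDepth 16000 in
/-- **`Gal(K/ℚ) ≅ C₇ ⋊ C₁₆` (`φ(1)` = inversion): a simple DEGENERATE abelian `56`-fold with CM by `K`**, with a rational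
`(q,q)` class outside the divisor ring on some power — by the balanced-set certificate `(T₀, D)` above, checked by `decide`.
[cite: Shimura1998, §6.2 Thm. 3 and §8.2 Prop. 26] [cite: Gordon1999HodgeAVSurvey, Thm. 6.4 and §9.3] -/
theorem exists_simple_degenerate_cyclic7_semidirect_16
    (φ : Multiplicative (ZMod (2 ^ (2 + 2))) →* MulAut (Multiplicative (ZMod 7)))
    (hφ : ∀ v : Multiplicative (ZMod 7), φ (Multiplicative.ofAdd 1) v = v⁻¹)
    (e : (K ≃ₐ[ℚ] K) ≃* Multiplicative (ZMod 7) ⋊[φ] Multiplicative (ZMod (2 ^ (2 + 2)))) :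
    ∃ (Φ : CMType K) (φ₀ : K →+* ℂ) (A : AbelianVariety ℂ) (ι : 𝓞 K →+* End A)
      (θ : K →+* Module.End ℂ (complexBetti A.X 1)),
      IsPrimitive (ℂ ≃+* ℂ) Φ.1 φ₀ ∧ ¬ IsNondegenerate Φ ∧ IsCMTypeRealisation Φ A ι θ ∧ A.IsSimple ∧ A.dim = 56 ∧
      ∃ n q : ℕ, ∃ x : complexBetti (⨁ fun _ : Fin n => A).X (2 * q), IsRationalClass x ∧
        IsOfHodgeType (⨁ fun _ : Fin n => A).dim (⨁ fun _ : Fin n => A).X (2 * q) q q x ∧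
        x ∉ divisorClassesSpan (⨁ fun _ : Fin n => A).X (⨁ fun _ : Fin n => A).dim q := by
  obtain ⟨Φ, φ₀, A, ι, θ, h1, h2, h3, h4, h5, h6⟩ :=
    exists_simple_degenerate_of_inversion_balanced (a := 2) (K := K) (by norm_num) (by norm_num) φ hφ e
      {(0, 1), (0, 3), (0, 5), (0, 7), (0, 8), (0, 10), (0, 12), (0, 14), (1, 5), (1, 7), (1, 8), (1, 9), (1, 10), (1, 11),
        (1, 12), (1, 14), (2, 0), (2, 1), (2, 2), (2, 11), (2, 12), (2, 13), (2, 14), (2, 15), (3, 0), (3, 1), (3, 3), (3, 5),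
        (3, 7), (3, 10), (3, 12), (3, 14), (4, 0), (4, 2), (4, 3), (4, 5), (4, 7), (4, 9), (4, 12), (4, 14), (5, 0), (5, 2),
        (5, 4), (5, 7), (5, 9), (5, 11), (5, 13), (5, 14), (6, 1), (6, 2), (6, 3), (6, 4), (6, 5), (6, 6), (6, 8), (6, 15)}
      (by decide) (by decide)
      {(0, 1), (0, 5), (1, 0), (1, 6), (1, 13), (1, 15), (2, 11), (2, 14), (3, 7), (3, 9), (4, 3), (4, 8)} (by decide) (by decide)
  exact ⟨Φ, φ₀, A, ι, θ, h1, h2, h3, h4, by norm_num at h5; exact h5, h6⟩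

end Summit.HodgeConjecture.CorCM.GaloisOddMetacyclic

end
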